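import Literature.AlgebraicGeometry.AbelianSchemes.PolarizedAbelianSchemeWithLevelBaseChangeCancel
import Literature.AlgebraicGeometry.AbelianSchemes.AbelianSchemeOverLevelBaseChange
import Literature.AlgebraicGeometry.RelativeSpec.ActionOverPullback
import HarnessLib

/-!
# The canonical action on a base-changed abelian scheme `A ×_Q S′` covering an action on `S′` over `Q`, as cartesian
# squares of group schemes ([SGA1] V §1; [MFK94] Def. 7.2)

Topic `AlgebraicGeometry/AbelianSchemes`; namespace `Literature.AlgebraicGeometry.AbelianSchemes.AbelianSchemeOver`.
THEOREMS ONLY (no definition, no named fact, no instance, no notation, no `sorry`; net Literature debt 0).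

For an abelian scheme `A → Q` and an action `ρ : ActionOver p G` of a group `G` on `S′` over `p : S′ → Q`, the group acts on the
CHOSEN base change `A_{S′} = A ×_Q S′ = A.baseChange p` (★ `AbelianSchemeOver.baseChange`, total space `pullback A.X.hom p`) by
`1_A × ρ(g)` — the tree's fibre-product action ★ `RelativeSpec.ActionOver.onPullback` with the TRIVIAL action on `A` and on `Q` —
viewed as an action over the (invariant) projection `pr_A : A ×_Q S′ → A`.  THIS FILE records, with no hypothesis on `A`, `p` or `G`:
each `1_A × ρ(g)` COVERS `ρ(g)` along the structure map `A_{S′} → S′` and IS A CARTESIAN SQUARE OF GROUP SCHEMES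
`A_{S′} ≅ A_{S′} ×_{S′, ρ(g)} S′` (★ `IsBaseChangeVia`), by cancellation of pull-back squares (★ `isBaseChangeVia_of_comp`:
the square along `ρ(g) ≫ p = p` is the chosen base-change square ★ `baseChange_isBaseChangeVia` again).  Together with ★
`baseChange_isBaseChangeVia` (`pr_A` is a base change along `p`) these are EXACTLY the data `ρA` / `hAB` / `hA` of the
base-quotient descent files (★ `AbelianSchemeBaseQuotientDescent`, ★ `PoincareBaseQuotientDescent`, ★ `DualPairBaseQuotientDescent`
and their `…OfNoetherian` / `…OfAffineBase` editions) in the case «`A` over `Q` given, `S′ → Q` a free finite quotient».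

* §1 `exists_actionOver_baseChange` — THE HEAD: `∃ ρA : ActionOver (pullback.fst A.X.hom p) G` with
  `ρA(g) = 1_A ×_{𝟙} ρ(g)` (Mathlib `pullback.map`), `ρA(g) ≫ π_{S′} = π_{S′} ≫ ρ(g)`, `A_{S′}.IsBaseChangeVia A p pr_A`, and
  `∀ g, A_{S′}.IsBaseChangeVia A_{S′} (ρ g) (ρA g)`.

Cell `hodgecm-mathlib` (D-0151), FLOOR 0 programme P1, child line `Cruxes/HDel/Lines/F3DualAbelianSchemeM` (B-typ04 (g15) v0-LINE
ed. 2 3f8748f0; pen B-plan1 (g19)), letter (Ma) `stub_F3Ma`: its output clauses «`ρA : ActionOver (pullback.fst A.X.hom p) G`,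
`(A.baseChange p).IsBaseChangeVia A p (pullback.fst A.X.hom p)`, `∀ γ₀, (A.baseChange p).IsBaseChangeVia (A.baseChange p)
(ρ.aut γ₀).hom (ρA.aut γ₀).hom`» are §1 VERBATIM for the cover `p : S′ → Spec R` of (Ma0) — so (Ma)'s genuine content is the
splitting of `K(L)` alone.  Count-neutral; HC_CM is proved only modulo the 7 printed citations until rung 0 closes; nothing here
is about HC.

Mathlib searched (pin): `pullback.map`, `MonoidHom.one_apply`, `Category.comp_id` (used); Mathlib has no group actions on
schemes over a base and no abelian schemes.

## References
* A. Grothendieck, *SGA 1*, Exp. V §1, Prop. 1.9 (actions over a base; base change). [SGA1]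
* D. Mumford, J. Fogarty, F. Kirwan, *Geometric Invariant Theory*, 3rd ed. (1994), Ch. 7 §2 Definition 7.2 (p. 129); Ch. 7 §3
  remark after Thm. 7.9 (p. 139). [MumfordFogartyKirwan1994]
* U. Görtz, T. Wedhorn, *Algebraic Geometry I*, 2nd ed. (2020), Prop. 4.16 (p. 101). [GortzWedhorn2020]
-/

noncomputable section

universe u

open CategoryTheory CategoryTheory.Limits AlgebraicGeometry

namespace Literature.AlgebraicGeometry.AbelianSchemes.AbelianSchemeOver

open Literature.AlgebraicGeometry.RelativeSpec

variable {S' Q : Scheme.{u}} {p : S' ⟶ Q} {G : Type*} [Group G] (ρ : ActionOver p G) (A : AbelianSchemeOver Q)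

/-! ### §1 The base-change action `1_A × ρ` on `A ×_Q S′` and its cartesian squares of group schemes -/

/-- **THE CANONICAL ACTION ON `A ×_Q S′` COVERING `ρ`, AS CARTESIAN SQUARES OF GROUP SCHEMES** ([SGA1] V §1; [MumfordFogartyKirwan1994]
Def. 7.2 / remark after Thm. 7.9).  For an abelian scheme `A → Q` and an action `ρ` of `G` on `S′` over `p : S′ → Q` there is an
action `ρA` of `G` on the total space `A ×_Q S′` of the chosen base change `A_{S′} = A.baseChange p`, over the projection
`pr_A : A ×_Q S′ → A`, with: `ρA(g) = 1_A ×_{𝟙_Q} ρ(g)` (Mathlib `pullback.map`; the tree's ★ `ActionOver.onPullback` with trivial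
actions on `A` and `Q`); `ρA(g)` covers `ρ(g)` along `A_{S′} → S′`; `pr_A` exhibits `A_{S′}` as the base change of `A` along `p`
as a group scheme (★ `baseChange_isBaseChangeVia`); and every `ρA(g)` is a CARTESIAN SQUARE OF GROUP SCHEMES over `ρ(g)` (★
`isBaseChangeVia_of_comp`, cancelling the chosen square along `ρ(g) ≫ p = p` against itself).  No hypothesis on
`A`, `p`, `G`.  These are the inputs `ρA`/`hAB`/`hA` of the base-quotient descent files when `p` is a free finite quotient.
[cite: SGA1, Exp. V §1, Prop. 1.9] [cite: MumfordFogartyKirwan1994, Ch. 7 §2 Definition 7.2 (p. 129)]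
[cite: GortzWedhorn2020, Prop. 4.16 (p. 101)] -/
theorem exists_actionOver_baseChange :
    ∃ ρA : ActionOver (pullback.fst A.X.hom p) G,
      (∀ g : G, (ρA.aut g).hom = pullback.map A.X.hom p A.X.hom p (𝟙 _) (ρ.aut g).hom (𝟙 _)
        (by rw [Category.id_comp, Category.comp_id]) (by rw [ρ.aut_comp, Category.comp_id])) ∧
      (∀ g : G, (ρA.aut g).hom ≫ (A.baseChange p).X.hom = (A.baseChange p).X.hom ≫ (ρ.aut g).hom) ∧
      (A.baseChange p).IsBaseChangeVia A p (pullback.fst A.X.hom p) ∧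
      ∀ g : G, (A.baseChange p).IsBaseChangeVia (A.baseChange p) (ρ.aut g).hom (ρA.aut g).hom := by
  -- compatibilities of the trivial actions on `A` and `Q` with `ρ` on `S′`
  have h₁ : ∀ g : G, ((1 : G →* Aut A.X.left) g).hom ≫ A.X.hom = A.X.hom ≫ ((1 : G →* Aut Q) g).hom := fun g => by
    rw [MonoidHom.one_apply, MonoidHom.one_apply]
    exact (Category.id_comp _).trans (Category.comp_id _).symm
  have h₂ : ∀ g : G, (ρ.aut g).hom ≫ p = p ≫ ((1 : G →* Aut Q) g).hom := fun g => by
    rw [MonoidHom.one_apply, ρ.aut_comp]; exact (Category.comp_id _).symm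
  -- `pr_A` is invariant
  have hr : ∀ g : G, (ActionOver.pullbackMapHom A.X.hom p 1 ρ.aut 1 h₁ h₂ g).hom ≫ pullback.fst A.X.hom p =
      pullback.fst A.X.hom p := fun g => by
    rw [ActionOver.pullbackMapHom_hom_fst, MonoidHom.one_apply]; exact Category.comp_id _
  let ρA : ActionOver (pullback.fst A.X.hom p) G := ActionOver.onPullback A.X.hom p 1 ρ.aut 1 h₁ h₂ _ hr
  have hρA : ∀ g : G, (ρA.aut g).hom = pullback.map A.X.hom p A.X.hom p (𝟙 _) (ρ.aut g).hom (𝟙 _)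
      (by rw [Category.id_comp, Category.comp_id]) (by rw [ρ.aut_comp, Category.comp_id]) := fun g => by
    apply pullback.hom_ext
    · rw [pullback.lift_fst]
      exact (ActionOver.pullbackMapHom_hom_fst A.X.hom p 1 ρ.aut 1 h₁ h₂ g).trans (by rw [MonoidHom.one_apply]; rfl)
    · rw [pullback.lift_snd]
      exact ActionOver.pullbackMapHom_hom_snd A.X.hom p 1 ρ.aut 1 h₁ h₂ g
  -- `ρA(g)` covers `ρ(g)` along `A_{S′} → S′ = pr_{S′}`
  have hcov : ∀ g : G, (ρA.aut g).hom ≫ (A.baseChange p).X.hom = (A.baseChange p).X.hom ≫ (ρ.aut g).hom := fun g => by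
    rw [baseChange_hom]
    exact ActionOver.pullbackMapHom_hom_snd A.X.hom p 1 ρ.aut 1 h₁ h₂ g
  have hAB : (A.baseChange p).IsBaseChangeVia A p (pullback.fst A.X.hom p) := A.baseChange_isBaseChangeVia p
  refine ⟨ρA, hρA, hcov, hAB, fun g => ?_⟩
  -- cancellation: the chosen square along `ρ(g) ≫ p = p` is the chosen square again
  have hAB' : (A.baseChange p).IsBaseChangeVia A ((ρ.aut g).hom ≫ p) (pullback.fst A.X.hom p) := by
    rw [ρ.aut_comp]; exact hAB
  exact isBaseChangeVia_of_comp hAB' hAB (ρA.aut g).hom (hr g) (hcov g)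

end Literature.AlgebraicGeometry.AbelianSchemes.AbelianSchemeOver

end
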